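import Summits.QuantumFields.YangMills.Theorems.SwapVirialDeficitSectorLaplaceBTubeCapRegion
import HarnessLib

/-!
# STUB (S-B) OF SKELETON ➎: READING THE CAPPED B-TUBE INTEGRALS ON `chartMeasure L` IN THE LETTERS `(δ, η)` (twin of ✓`…SectorLaplaceBTubeHubCot` for ✓`BTubeCap L τ X₁`)
# (free-hands support of ⟨stmt-QuantumFields-24197⟩ `SwapVirialDeficit.SwapGluedStiffness` ∕ ⟨24194⟩; cell ym-idea-1, LEAD g99 ruling 2026-08-31 20:48Z ∕ 20:59Z)

* §1 ★ `mem_BTubeCap_iff_cot` (for `im a ≠ 0`: `(a,η) ∈ BTubeCap L τ X₁ ↔ (δ-window ∧ τ ≤ √(η_x1²+η_x2²)) ∧ |η_x0| ≤ X₁√(1+η_x1²+η_x2²)` — the cap does not see the hub),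
  `measurableSet_BTubeCap`;
* §2 ★★★ `setLIntegral_BTubeCap_eq_hubCot` (every measurable `g`), ★★ `setIntegral_BTubeCap_exp_eq_hubCot`, ★★ `setIntegral_BTubeCap_action_eq_hubCot` — the two Bochner integrals of
  g47's `stub_B_stiff` on ✓`BTubeCap L τ X₁` equal `coneConst·π` times the integrals over the capped region `RgCap` of ✓`bTubeCap_stiff_of_farFloor`.

HONEST LABEL: measure-theoretic reading only; (S-B) is NOT closed (far floor on the capped tube [w3 g67]; threshold bookkeeping); (S-core), (S-001), ⟨24197⟩ ∕ ⟨24194⟩ OPEN; own crux ⟨22884⟩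
OPEN (blocked-on ⟨19935⟩); the Yang–Mills mass gap is NOT proved; no summit is proved by a line.  THEOREMS ONLY (0 `def`, 0 `sorry`), standard axioms; the
`attribute [local instance]` block is the series' measurable structure on `ℍ` (as in ✓`SectorLaplaceDefs`; nothing overridden).  Width seat ym-line-sfw-p2-w2 g59
(cell ym-idea-1, free hands), `--supports stmt-QuantumFields-24197`.  References: [folklore].
-/


set_option autoImplicit false
set_option synthInstance.maxSize 1024

noncomputable section

open MeasureTheory Quaternion Set
open scoped Quaternion ENNReal BigOperators
open Literature.MathematicalPhysics.QuantumLattice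
open Literature.MathematicalPhysics.QuantumFieldTheory hiding SU2
open Summit.QuantumFields.YangMills.Theorems.SwapTwistDeficit.ToronLog

attribute [local instance] Literature.Analysis.FluidPDE.Tao2016.quatMeasurableSpace
  Literature.Analysis.FluidPDE.Tao2016.quatBorelSpace
  Literature.MathematicalPhysics.QuantumLattice.secondCountableTopology_su2

namespace Summit.QuantumFields.YangMills.Theorems.SwapVirialDeficit.BlowUpRing

open Summit.QuantumFields.YangMills.Theorems.FemtoTransferGap
open Summit.QuantumFields.YangMills.Theorems.FemtoTransferGap.TT
open Summit.QuantumFields.YangMills.Theorems.VirialFluxGap.RingDeficit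
open Summit.QuantumFields.YangMills.Theorems.SwapVirialDeficit.SectorLaplace

variable {L : ℕ} [NeZero L]

/-! ## §1 The capped tube in the letters `(δ, η)` -/

omit [NeZero L] in
/-- ★ **THE CAPPED B-TUBE IN THE LETTERS `(δ, η)`**: for `im a ≠ 0`, `(a, η) ∈ BTubeCap L τ X₁ ↔ ((δ-window) ∧ τ ≤ √(η_x1²+η_x2²)) ∧ |η_x0| ≤ X₁√(1+η_x1²+η_x2²)`
(✓`mem_BTube_iff_cot`; the cap is a condition on `η` alone). [folklore] -/
theorem mem_BTubeCap_iff_cot {a : ℍ} (him : a.im ≠ 0) (η : GnoCoord L) (τ X₁ : ℝ) :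
    (a, η) ∈ BTubeCap L τ X₁ ↔
      ((4 * (a.re / ‖a.im‖) ^ 2 / (1 + (a.re / ‖a.im‖) ^ 2) ^ 2 < τ ∧ τ ≤ (1 + (a.re / ‖a.im‖) ^ 2)⁻¹ ∧
          |a.re / ‖a.im‖| < τ * Real.sqrt (1 + (a.re / ‖a.im‖) ^ 2)) ∧
        τ ≤ Real.sqrt (η.1.1 1 ^ 2 + η.1.1 2 ^ 2)) ∧
      |η.1.1 0| ≤ X₁ * Real.sqrt (1 + η.1.1 1 ^ 2 + η.1.1 2 ^ 2) := by
  rw [mem_BTubeCap_iff, mem_BTube_iff_cot him]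

omit [NeZero L] in
/-- `BTubeCap L τ X₁` is measurable. [folklore] -/
theorem measurableSet_BTubeCap (τ X₁ : ℝ) : MeasurableSet (BTubeCap L τ X₁) := by
  rw [BTubeCap_def]
  refine (measurableSet_BTube τ).inter (measurableSet_le ?_ ?_)
  · exact ((measurable_pi_apply 0).comp (measurable_fst.comp (measurable_fst.comp measurable_snd))).abs
  · exact measurable_const.mul ((measurable_const.add (((measurable_pi_apply 1).comp (measurable_fst.comp (measurable_fst.comp measurable_snd))).pow_const 2)).add
      (((measurable_pi_apply 2).comp (measurable_fst.comp (measurable_fst.comp measurable_snd))).pow_const 2)).sqrt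

/-! ## §2 The capped B-tube integrals as capped window-cylinder integrals against `μ_B` -/

/-- ★★★ **THE CAPPED B-TUBE INTEGRALS IN THE LETTERS `(δ, η)`**: for every measurable `g : ℝ → ℝ≥0∞`, sector `z`, character `χ`, signs `ε`, cut `τ` and cap `X₁`,
`∫⁻_{BTubeCap L τ X₁} g(F̂(a, ε, η)) d(chartMeasure) = coneConst·π · ∫⁻_{{δ ∈ W_τ} ∩ {τ ≤ √(η_x1²+η_x2²)} ∩ {|η_x0| ≤ X₁√(1+η_x1²+η_x2²)}} g(F̂(hubAt δ 1, ε, η)) dμ_B(δ, η)`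
(✓`gnoDeficit_eq_hubCot` and `mem_BTube_iff_cot` off the cone-null real axis, then `lintegral_chartMeasure_hubCot_muB`). [folklore] -/
theorem setLIntegral_BTubeCap_eq_hubCot (z : Fin 3 → Bool) (χ : Site 3 L → SU2) (ε : GnoSign L) (τ X₁ : ℝ) (g : ℝ → ℝ≥0∞) (hg : Measurable g) :
    ∫⁻ x in BTubeCap L τ X₁, g (gnoDeficit z χ x.1 ε x.2) ∂(chartMeasure L) =
      ENNReal.ofReal (coneConst * Real.pi) *
        ∫⁻ p in {p : ℝ × GnoCoord L | 4 * p.1 ^ 2 / (1 + p.1 ^ 2) ^ 2 < τ ∧ τ ≤ (1 + p.1 ^ 2)⁻¹ ∧ |p.1| < τ * Real.sqrt (1 + p.1 ^ 2)} ∩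
            {p : ℝ × GnoCoord L | τ ≤ Real.sqrt (p.2.1.1 1 ^ 2 + p.2.1.1 2 ^ 2)} ∩
            {p : ℝ × GnoCoord L | |p.2.1.1 0| ≤ X₁ * Real.sqrt (1 + p.2.1.1 1 ^ 2 + p.2.1.1 2 ^ 2)},
          g (gnoDeficit z χ (hubAt p.1 1) ε p.2)
          ∂((volume : Measure (ℝ × GnoCoord L)).withDensity fun p => ENNReal.ofReal (((1 + p.1 ^ 2)⁻¹) ^ 2 * gnoDensity p.2)) := by
  set Rg : Set (ℝ × GnoCoord L) := {p : ℝ × GnoCoord L | 4 * p.1 ^ 2 / (1 + p.1 ^ 2) ^ 2 < τ ∧ τ ≤ (1 + p.1 ^ 2)⁻¹ ∧ |p.1| < τ * Real.sqrt (1 + p.1 ^ 2)} ∩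
    {p : ℝ × GnoCoord L | τ ≤ Real.sqrt (p.2.1.1 1 ^ 2 + p.2.1.1 2 ^ 2)} ∩
    {p : ℝ × GnoCoord L | |p.2.1.1 0| ≤ X₁ * Real.sqrt (1 + p.2.1.1 1 ^ 2 + p.2.1.1 2 ^ 2)} with hRg
  have hRgm : MeasurableSet Rg := measurableSet_bCapRegion τ X₁
  set H : ℝ × GnoCoord L → ℝ≥0∞ := Rg.indicator fun p => g (gnoDeficit z χ (hubAt p.1 1) ε p.2) with hHdef
  have hHm : Measurable H := (hg.comp (measurable_bDeficit z χ ε)).indicator hRgm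
  rw [← lintegral_indicator (measurableSet_BTubeCap τ X₁), ← lintegral_indicator hRgm]
  -- a.e. the two indicators agree in the letters `(δ, η)`
  have hae : (fun x : ℍ × GnoCoord L => (BTubeCap L τ X₁).indicator (fun x => g (gnoDeficit z χ x.1 ε x.2)) x) =ᵐ[chartMeasure L]
      fun x : ℍ × GnoCoord L => H (x.1.re / ‖x.1.im‖, x.2) := by
    filter_upwards [ae_im_ne_zero_chartMeasure (L := L)] with x him
    have hmem : x ∈ BTubeCap L τ X₁ ↔ (x.1.re / ‖x.1.im‖, x.2) ∈ Rg := by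
      rw [hRg, show x = (x.1, x.2) from rfl, mem_BTubeCap_iff_cot him]
      simp only [mem_inter_iff, mem_setOf_eq]
    by_cases hx : x ∈ BTubeCap L τ X₁
    · rw [indicator_of_mem hx, hHdef, indicator_of_mem (hmem.1 hx), gnoDeficit_eq_hubCot z χ him]
    · rw [indicator_of_notMem hx, hHdef, indicator_of_notMem (fun h => hx (hmem.2 h))]
  rw [lintegral_congr_ae hae, lintegral_chartMeasure_hubCot_muB H hHm]

/-- ★★ **THE CAPPED B-TUBE PARTITION FUNCTION IN THE LETTERS `(δ, η)`** (the left side of g47's `stub_B_stiff` on ✓`BTubeCap`):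
`∫_{BTubeCap L τ X₁} e^{−bF̂} d(chartMeasure) = coneConst·π · ∫_{RgCap} e^{−bF̂(hubAt δ 1, ε, η)} dμ_B`. [folklore] -/
theorem setIntegral_BTubeCap_exp_eq_hubCot (z : Fin 3 → Bool) (χ : Site 3 L → SU2) (ε : GnoSign L) (τ X₁ b : ℝ) :
    ∫ x in BTubeCap L τ X₁, Real.exp (-(b * gnoDeficit z χ x.1 ε x.2)) ∂(chartMeasure L) =
      coneConst * Real.pi *
        ∫ p in {p : ℝ × GnoCoord L | 4 * p.1 ^ 2 / (1 + p.1 ^ 2) ^ 2 < τ ∧ τ ≤ (1 + p.1 ^ 2)⁻¹ ∧ |p.1| < τ * Real.sqrt (1 + p.1 ^ 2)} ∩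
            {p : ℝ × GnoCoord L | τ ≤ Real.sqrt (p.2.1.1 1 ^ 2 + p.2.1.1 2 ^ 2)} ∩
            {p : ℝ × GnoCoord L | |p.2.1.1 0| ≤ X₁ * Real.sqrt (1 + p.2.1.1 1 ^ 2 + p.2.1.1 2 ^ 2)},
          Real.exp (-(b * gnoDeficit z χ (hubAt p.1 1) ε p.2))
          ∂((volume : Measure (ℝ × GnoCoord L)).withDensity fun p => ENNReal.ofReal (((1 + p.1 ^ 2)⁻¹) ^ 2 * gnoDensity p.2)) := by
  have hm1 : Measurable fun x : ℍ × GnoCoord L => Real.exp (-(b * gnoDeficit z χ x.1 ε x.2)) :=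
    ((measurable_gnoDeficit_uncurry z χ ε).const_mul b).neg.exp
  have hm2 : Measurable fun p : ℝ × GnoCoord L => Real.exp (-(b * gnoDeficit z χ (hubAt p.1 1) ε p.2)) :=
    ((measurable_bDeficit z χ ε).const_mul b).neg.exp
  rw [integral_eq_lintegral_of_nonneg_ae (Filter.Eventually.of_forall fun x => (Real.exp_pos _).le) hm1.aestronglyMeasurable.restrict,
    integral_eq_lintegral_of_nonneg_ae (Filter.Eventually.of_forall fun x => (Real.exp_pos _).le) hm2.aestronglyMeasurable.restrict]
  have h := setLIntegral_BTubeCap_eq_hubCot z χ ε τ X₁ (fun t => ENNReal.ofReal (Real.exp (-(b * t)))) (by fun_prop)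
  rw [h, ENNReal.toReal_mul, ENNReal.toReal_ofReal (mul_pos coneConst_pos Real.pi_pos).le]

/-- ★★ **THE CAPPED B-TUBE ACTION INTEGRAL IN THE LETTERS `(δ, η)`** (the right side of g47's `stub_B_stiff` on ✓`BTubeCap`):
`∫_{BTubeCap L τ X₁} F̂e^{−bF̂} d(chartMeasure) = coneConst·π · ∫_{RgCap} F̂(hubAt δ 1, ε, η)e^{−bF̂(hubAt δ 1, ε, η)} dμ_B`. [folklore] -/
theorem setIntegral_BTubeCap_action_eq_hubCot (z : Fin 3 → Bool) (χ : Site 3 L → SU2) (ε : GnoSign L) (τ X₁ b : ℝ) :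
    ∫ x in BTubeCap L τ X₁, gnoDeficit z χ x.1 ε x.2 * Real.exp (-(b * gnoDeficit z χ x.1 ε x.2)) ∂(chartMeasure L) =
      coneConst * Real.pi *
        ∫ p in {p : ℝ × GnoCoord L | 4 * p.1 ^ 2 / (1 + p.1 ^ 2) ^ 2 < τ ∧ τ ≤ (1 + p.1 ^ 2)⁻¹ ∧ |p.1| < τ * Real.sqrt (1 + p.1 ^ 2)} ∩
            {p : ℝ × GnoCoord L | τ ≤ Real.sqrt (p.2.1.1 1 ^ 2 + p.2.1.1 2 ^ 2)} ∩
            {p : ℝ × GnoCoord L | |p.2.1.1 0| ≤ X₁ * Real.sqrt (1 + p.2.1.1 1 ^ 2 + p.2.1.1 2 ^ 2)},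
          gnoDeficit z χ (hubAt p.1 1) ε p.2 * Real.exp (-(b * gnoDeficit z χ (hubAt p.1 1) ε p.2))
          ∂((volume : Measure (ℝ × GnoCoord L)).withDensity fun p => ENNReal.ofReal (((1 + p.1 ^ 2)⁻¹) ^ 2 * gnoDensity p.2)) := by
  have hm1 : Measurable fun x : ℍ × GnoCoord L => gnoDeficit z χ x.1 ε x.2 * Real.exp (-(b * gnoDeficit z χ x.1 ε x.2)) :=
    (measurable_gnoDeficit_uncurry z χ ε).mul ((measurable_gnoDeficit_uncurry z χ ε).const_mul b).neg.exp
  have hm2 : Measurable fun p : ℝ × GnoCoord L => gnoDeficit z χ (hubAt p.1 1) ε p.2 * Real.exp (-(b * gnoDeficit z χ (hubAt p.1 1) ε p.2)) :=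
    (measurable_bDeficit z χ ε).mul ((measurable_bDeficit z χ ε).const_mul b).neg.exp
  rw [integral_eq_lintegral_of_nonneg_ae (Filter.Eventually.of_forall fun x => mul_nonneg (gnoDeficit_nonneg _ _ _ _ _) (Real.exp_pos _).le)
      hm1.aestronglyMeasurable.restrict,
    integral_eq_lintegral_of_nonneg_ae (Filter.Eventually.of_forall fun x => mul_nonneg (gnoDeficit_nonneg _ _ _ _ _) (Real.exp_pos _).le)
      hm2.aestronglyMeasurable.restrict]
  have h := setLIntegral_BTubeCap_eq_hubCot z χ ε τ X₁ (fun t => ENNReal.ofReal (t * Real.exp (-(b * t)))) (by fun_prop)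
  rw [h, ENNReal.toReal_mul, ENNReal.toReal_ofReal (mul_pos coneConst_pos Real.pi_pos).le]

end Summit.QuantumFields.YangMills.Theorems.SwapVirialDeficit.BlowUpRing

end
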